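import Summits.Ventures.YMGap.Thresholds.OneLinkRemainderGradient
import Summits.Ventures.YMGap.Thresholds.OneLinkPsiTwoGradientL2
import HarnessLib

/-!
# Venture YMGap — the one-link modulus beyond first order, part 14: the `L²(ν_B)` gradient norms of the cubic remainder `c₃`
# and of `u + ψ₂` (Minkowski step, symbolic second moments)

HONEST FRAMING: venture file of the cell `pub-ymgap` (QuantumFields programme), strong-coupling LATTICE bookkeeping for `SU(N)`
lattice Yang–Mills; nothing about the continuum or the mass gap in the Clay sense.  No number of record («F5», part 2c, of the cell
note `HOME/p2/ONE-LINK-HIERARCHY.md` §4 (4.5)–(4.6), CRUDE column: quadratic words and `Im tr(gB)` bounded pointwise).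

WHAT.  `ν_B(dg) ∝ exp(N Re tr(gB)) dg` on `SU(N)`, `N ≥ 3`; `Z₁ = √(∫‖tr(gB)‖² dν_B)`, `Z₂ = √(∫‖tr(gΔ)‖² dν_B)` stay symbolic
(bounded by `OneLinkSecondMoments.sqrt_integral_normSq_trace_le` in the next file).  With `r = ‖B‖_op`, `κ_w = N²/(4(N²−4))`,
`κ_t = N/(2(N²−4))`, `c = 1/(4N)`, `κ₁ = κ_t + c`:
* `sqrt_integral_Gam_c3_le`: `√(∫ Γ(c₃,c₃) dν_B) ≤ a + b₁ Z₁ + b₂ Z₂` with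
  `a = 4κ_w r²‖Δ‖_F + ‖B‖_F²‖Δ‖_F (2κ_w/N + (3/2)κ₁ + ½(κ_t − c))`, `b₁ = ‖Δ‖_F r (4κ_w/N + κ₁ + 2κ_t)`,
  `b₂ = ‖B‖_F (κ₁ r + 2κ_t r + (2κ_t/N)√N‖B‖_F)` — from the pointwise `Γ(c₃,c₃) ≤ P²` (`Gam_c3_le`) with `|Im tr(gB)| ≤ ‖tr(gB)‖`,
  `|Im tr(gB)| ≤ N r`, `‖tr(gB)‖ ≤ √N‖B‖_F`, `‖tr(gΔgB)‖ ≤ ‖Δ‖_F‖B‖_F`, `‖tr(gBgB)‖ ≤ ‖B‖_F²`, and Minkowski in `L²(ν_B)`;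
* `sqrt_integral_Gam_upsi_le`: `√(∫ Γ(u+ψ₂, u+ψ₂) dν_B) ≤ ‖Δ‖_F + 2κ_w r‖Δ‖_F + κ₁(‖Δ‖_F Z₁ + ‖B‖_F Z₂)`, `u = Re tr(·Δ)`.
These are the two `L²(ν)` norms left symbolic in `OneLinkLevelTwoCovariance.cov_linear_le_levelTwo`.

References: cell note `HOME/p2/ONE-LINK-HIERARCHY.md` §4; `HOME/p2/hier/LEAN-SPEC-REMAINING.md` F5.2c.
-/

noncomputable section

open scoped Matrix ComplexConjugate BigOperators ContDiff Matrix.Norms.Frobenius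
open Matrix Complex Finset MeasureTheory ProbabilityTheory
open Literature.MathematicalPhysics.QuantumFieldTheory
open Literature.MathematicalPhysics.QuantumFieldTheory.SUNBakryEmery

namespace Summit.Ventures.YMGap.OneLinkEigen

variable {N : ℕ}

/-- Pointwise word bounds on `SU(N)`: `‖tr(gM₁gM₂)‖ ≤ ‖M₁‖_F ‖M₂‖_F`. [folklore] -/
theorem norm_trace_quad_su_le (M₁ M₂ : Matrix (Fin N) (Fin N) ℂ) (g : SUN N) :
    ‖((g : Matrix (Fin N) (Fin N) ℂ) * M₁ * g * M₂).trace‖ ≤ frobNorm M₁ * frobNorm M₂ := by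
  have hg := SUN.mem_unitaryGroup g
  rw [show (g : Matrix (Fin N) (Fin N) ℂ) * M₁ * g * M₂ = ((g : Matrix (Fin N) (Fin N) ℂ) * M₁) * ((g : Matrix (Fin N) (Fin N) ℂ) * M₂) by
    simp only [Matrix.mul_assoc]]
  refine (norm_trace_mul_le _ _).trans ?_
  rw [frobNorm_unitary_mul hg, frobNorm_unitary_mul hg]

/-- `‖tr(gM)‖ ≤ √N ‖M‖_F` on `SU(N)`. [folklore] -/
theorem norm_trace_su_mul_le (M : Matrix (Fin N) (Fin N) ℂ) (g : SUN N) :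
    ‖((g : Matrix (Fin N) (Fin N) ℂ) * M).trace‖ ≤ Real.sqrt N * frobNorm M := by
  refine (norm_trace_mul_le _ _).trans ?_
  rw [frobNorm_su]

/-- `|Im tr(gB)| ≤ N ‖B‖_op` on `SU(N)`. [folklore] -/
theorem abs_im_trace_su_mul_le_opNorm (B : Matrix (Fin N) (Fin N) ℂ) (g : SUN N) :
    |((g : Matrix (Fin N) (Fin N) ℂ) * B).trace.im| ≤ N * matrixOpNorm B := by
  rw [trace_mul_comm]; exact abs_im_trace_mul_su_le B g

/-- **The pointwise majorant of `P` that is affine in `‖tr(gB)‖, ‖tr(gΔ)‖`** (crude column: quadratic words and products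
bounded by `‖tr(gΔgB)‖ ≤ ‖Δ‖_F‖B‖_F`, `‖tr(gBgB)‖ ≤ ‖B‖_F²`, `|Im tr(gB)| ≤ N‖B‖_op`, `‖tr(gB)‖ ≤ √N‖B‖_F`). [folklore] -/
theorem c3bound_le_affine (hN : 3 ≤ N) (B Δ : Matrix (Fin N) (Fin N) ℂ) (g : SUN N) :
    4 * ((N : ℝ) ^ 2 / (4 * ((N : ℝ) ^ 2 - 4))) * matrixOpNorm B ^ 2 * frobNorm Δ
        + 2 * ((N : ℝ) ^ 2 / (4 * ((N : ℝ) ^ 2 - 4))) / N *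
          (2 * matrixOpNorm B * frobNorm Δ * |((g : Matrix (Fin N) (Fin N) ℂ) * B).trace.im|
            + frobNorm B * ‖((g : Matrix (Fin N) (Fin N) ℂ) * Δ * g * B).trace‖)
        + 1 / 2 * ((N : ℝ) / (2 * ((N : ℝ) ^ 2 - 4)) + 1 / (4 * (N : ℝ))) *
          (2 * matrixOpNorm B * frobNorm B * ‖((g : Matrix (Fin N) (Fin N) ℂ) * Δ).trace‖
            + frobNorm Δ * ‖((g : Matrix (Fin N) (Fin N) ℂ) * B * g * B).trace‖)
        + 1 / 2 * ((N : ℝ) / (2 * ((N : ℝ) ^ 2 - 4)) + 1 / (4 * (N : ℝ))) *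
          (2 * matrixOpNorm B * frobNorm Δ * ‖((g : Matrix (Fin N) (Fin N) ℂ) * B).trace‖
            + frobNorm B * ‖((g : Matrix (Fin N) (Fin N) ℂ) * Δ * g * B).trace‖)
        + 1 / 2 * ((N : ℝ) / (2 * ((N : ℝ) ^ 2 - 4)) - 1 / (4 * (N : ℝ))) * frobNorm B ^ 2 * frobNorm Δ
        + 1 / 2 * ((N : ℝ) / (2 * ((N : ℝ) ^ 2 - 4)) + 1 / (4 * (N : ℝ))) * frobNorm B ^ 2 * frobNorm Δ
        + 2 * ((N : ℝ) / (2 * ((N : ℝ) ^ 2 - 4))) / N *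
          (frobNorm B * |((g : Matrix (Fin N) (Fin N) ℂ) * B).trace.im| * ‖((g : Matrix (Fin N) (Fin N) ℂ) * Δ).trace‖
            + frobNorm Δ * |((g : Matrix (Fin N) (Fin N) ℂ) * B).trace.im| * ‖((g : Matrix (Fin N) (Fin N) ℂ) * B).trace‖
            + frobNorm B * ‖((g : Matrix (Fin N) (Fin N) ℂ) * B).trace‖ * ‖((g : Matrix (Fin N) (Fin N) ℂ) * Δ).trace‖) ≤
      (4 * ((N : ℝ) ^ 2 / (4 * ((N : ℝ) ^ 2 - 4))) * matrixOpNorm B ^ 2 * frobNorm Δ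
          + frobNorm B ^ 2 * frobNorm Δ * (2 * ((N : ℝ) ^ 2 / (4 * ((N : ℝ) ^ 2 - 4))) / N
            + 3 / 2 * ((N : ℝ) / (2 * ((N : ℝ) ^ 2 - 4)) + 1 / (4 * (N : ℝ)))
            + 1 / 2 * ((N : ℝ) / (2 * ((N : ℝ) ^ 2 - 4)) - 1 / (4 * (N : ℝ)))))
        + frobNorm Δ * matrixOpNorm B * (4 * ((N : ℝ) ^ 2 / (4 * ((N : ℝ) ^ 2 - 4))) / N
            + ((N : ℝ) / (2 * ((N : ℝ) ^ 2 - 4)) + 1 / (4 * (N : ℝ))) + 2 * ((N : ℝ) / (2 * ((N : ℝ) ^ 2 - 4)))) *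
          ‖((g : Matrix (Fin N) (Fin N) ℂ) * B).trace‖
        + frobNorm B * (((N : ℝ) / (2 * ((N : ℝ) ^ 2 - 4)) + 1 / (4 * (N : ℝ))) * matrixOpNorm B
            + 2 * ((N : ℝ) / (2 * ((N : ℝ) ^ 2 - 4))) * matrixOpNorm B
            + 2 * ((N : ℝ) / (2 * ((N : ℝ) ^ 2 - 4))) / N * Real.sqrt N * frobNorm B) *
          ‖((g : Matrix (Fin N) (Fin N) ℂ) * Δ).trace‖ := by
  have hN0 : N ≠ 0 := by omega
  have h3 : (3 : ℝ) ≤ N := by exact_mod_cast hN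
  have hN4 : (0 : ℝ) < (N : ℝ) ^ 2 - 4 := by nlinarith
  have hNpos : (0 : ℝ) < N := by linarith
  have hsN : 0 < Real.sqrt N := Real.sqrt_pos.2 hNpos
  set κw : ℝ := (N : ℝ) ^ 2 / (4 * ((N : ℝ) ^ 2 - 4)) with hκw
  set κt : ℝ := (N : ℝ) / (2 * ((N : ℝ) ^ 2 - 4)) with hκt
  set c : ℝ := 1 / (4 * (N : ℝ)) with hc
  have hκw0 : 0 ≤ κw := by positivity
  have hκt0 : 0 ≤ κt := by positivity
  have hc0 : 0 ≤ c := by positivity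
  set Q : Matrix (Fin N) (Fin N) ℂ := (g : Matrix (Fin N) (Fin N) ℂ) with hQ
  set r := matrixOpNorm B with hr
  set nB := frobNorm B with hnB
  set nD := frobNorm Δ with hnD
  set z1 := ‖(Q * B).trace‖ with hz1
  set z2 := ‖(Q * Δ).trace‖ with hz2
  set X := |(Q * B).trace.im| with hX
  set w := ‖(Q * Δ * Q * B).trace‖ with hw
  set wBB := ‖(Q * B * Q * B).trace‖ with hwBB
  have hr0 : 0 ≤ r := matrixOpNorm_nonneg B
  have hnB0 : 0 ≤ nB := frobNorm_nonneg B
  have hnD0 : 0 ≤ nD := frobNorm_nonneg Δ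
  have hz10 : 0 ≤ z1 := norm_nonneg _
  have hz20 : 0 ≤ z2 := norm_nonneg _
  have hX0 : 0 ≤ X := abs_nonneg _
  -- pointwise atom bounds
  have bX1 : X ≤ z1 := abs_im_le_norm' _
  have bX2 : X ≤ N * r := by rw [hX, hQ]; exact abs_im_trace_su_mul_le_opNorm B g
  have bz1 : z1 ≤ Real.sqrt N * nB := by rw [hz1, hQ]; exact norm_trace_su_mul_le B g
  have bw : w ≤ nD * nB := by rw [hw, hQ]; exact norm_trace_quad_su_le Δ B g
  have bwBB : wBB ≤ nB * nB := by rw [hwBB, hQ]; exact norm_trace_quad_su_le B B g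
  -- the variable pieces
  have p1 : 2 * r * nD * X ≤ 2 * r * nD * z1 := mul_le_mul_of_nonneg_left bX1 (by positivity)
  have p2 : nB * w ≤ nB * (nD * nB) := mul_le_mul_of_nonneg_left bw hnB0
  have p3 : nD * wBB ≤ nD * (nB * nB) := mul_le_mul_of_nonneg_left bwBB hnD0
  have p4 : nB * X * z2 ≤ nB * (N * r) * z2 :=
    mul_le_mul_of_nonneg_right (mul_le_mul_of_nonneg_left bX2 hnB0) hz20
  have p5 : nD * X * z1 ≤ nD * (N * r) * z1 :=
    mul_le_mul_of_nonneg_right (mul_le_mul_of_nonneg_left bX2 hnD0) hz10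
  have p6 : nB * z1 * z2 ≤ nB * (Real.sqrt N * nB) * z2 :=
    mul_le_mul_of_nonneg_right (mul_le_mul_of_nonneg_left bz1 hnB0) hz20
  have hκ1 : 0 ≤ κt + c := add_nonneg hκt0 hc0
  have q1 := mul_le_mul_of_nonneg_left p1 (by positivity : (0 : ℝ) ≤ 2 * κw / N)
  have q2 := mul_le_mul_of_nonneg_left p2 (by positivity : (0 : ℝ) ≤ 2 * κw / N)
  have q3 := mul_le_mul_of_nonneg_left p3 (by positivity : (0 : ℝ) ≤ 1 / 2 * (κt + c))
  have q3' := mul_le_mul_of_nonneg_left p2 (by positivity : (0 : ℝ) ≤ 1 / 2 * (κt + c))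
  have q4 := mul_le_mul_of_nonneg_left p4 (by positivity : (0 : ℝ) ≤ 2 * κt / N)
  have q5 := mul_le_mul_of_nonneg_left p5 (by positivity : (0 : ℝ) ≤ 2 * κt / N)
  have q6 := mul_le_mul_of_nonneg_left p6 (by positivity : (0 : ℝ) ≤ 2 * κt / N)
  have hNne : (N : ℝ) ≠ 0 := hNpos.ne'
  have e4 : 2 * κt / N * (nB * (N * r) * z2) = 2 * κt * nB * r * z2 := by
    rw [div_mul_eq_mul_div, div_eq_iff hNne]; ring
  have e5 : 2 * κt / N * (nD * (N * r) * z1) = 2 * κt * nD * r * z1 := by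
    rw [div_mul_eq_mul_div, div_eq_iff hNne]; ring
  rw [e4] at q4
  rw [e5] at q5
  simp only [div_eq_mul_inv] at q1 q2 q3 q3' q4 q5 q6 ⊢
  linarith [q1, q2, q3, q3', q4, q5, q6]

/-- **The `L²(ν_B)` gradient norm of the cubic remainder (crude column)**: `√(∫ Γ(c₃,c₃) dν_B) ≤ a + b₁ Z₁ + b₂ Z₂` with the
constants of `c3bound_le_affine` and `Z₁ = √(∫‖tr(gB)‖² dν_B)`, `Z₂ = √(∫‖tr(gΔ)‖² dν_B)`. [folklore] -/
theorem sqrt_integral_Gam_c3_le (hN : 3 ≤ N) (B Δ : Matrix (Fin N) (Fin N) ℂ) :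
    Real.sqrt (∫ g, Gam (Gam (pot 1 B) fun Q : Matrix (Fin N) (Fin N) ℂ =>
          -((N : ℝ) ^ 2 / (4 * ((N : ℝ) ^ 2 - 4))) * (Q * Δ * Q * B).trace.re
            + ((N : ℝ) / (2 * ((N : ℝ) ^ 2 - 4))) * ((Q * B).trace * (Q * Δ).trace).re
            - (1 / (4 * (N : ℝ))) * ((Q * B).trace * (starRingEnd ℂ) (Q * Δ).trace).re)
        (Gam (pot 1 B) fun Q : Matrix (Fin N) (Fin N) ℂ =>
          -((N : ℝ) ^ 2 / (4 * ((N : ℝ) ^ 2 - 4))) * (Q * Δ * Q * B).trace.re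
            + ((N : ℝ) / (2 * ((N : ℝ) ^ 2 - 4))) * ((Q * B).trace * (Q * Δ).trace).re
            - (1 / (4 * (N : ℝ))) * ((Q * B).trace * (starRingEnd ℂ) (Q * Δ).trace).re) g
        ∂(haarProbability (SUN N)).tilted (fun g => (N : ℝ) * ((g : Matrix (Fin N) (Fin N) ℂ) * B).trace.re)) ≤
      (4 * ((N : ℝ) ^ 2 / (4 * ((N : ℝ) ^ 2 - 4))) * matrixOpNorm B ^ 2 * frobNorm Δ
          + frobNorm B ^ 2 * frobNorm Δ * (2 * ((N : ℝ) ^ 2 / (4 * ((N : ℝ) ^ 2 - 4))) / N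
            + 3 / 2 * ((N : ℝ) / (2 * ((N : ℝ) ^ 2 - 4)) + 1 / (4 * (N : ℝ)))
            + 1 / 2 * ((N : ℝ) / (2 * ((N : ℝ) ^ 2 - 4)) - 1 / (4 * (N : ℝ)))))
        + frobNorm Δ * matrixOpNorm B * (4 * ((N : ℝ) ^ 2 / (4 * ((N : ℝ) ^ 2 - 4))) / N
            + ((N : ℝ) / (2 * ((N : ℝ) ^ 2 - 4)) + 1 / (4 * (N : ℝ))) + 2 * ((N : ℝ) / (2 * ((N : ℝ) ^ 2 - 4)))) *
          Real.sqrt (∫ g, ‖((g : Matrix (Fin N) (Fin N) ℂ) * B).trace‖ ^ 2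
            ∂(haarProbability (SUN N)).tilted (fun g => (N : ℝ) * ((g : Matrix (Fin N) (Fin N) ℂ) * B).trace.re))
        + frobNorm B * (((N : ℝ) / (2 * ((N : ℝ) ^ 2 - 4)) + 1 / (4 * (N : ℝ))) * matrixOpNorm B
            + 2 * ((N : ℝ) / (2 * ((N : ℝ) ^ 2 - 4))) * matrixOpNorm B
            + 2 * ((N : ℝ) / (2 * ((N : ℝ) ^ 2 - 4))) / N * Real.sqrt N * frobNorm B) *
          Real.sqrt (∫ g, ‖((g : Matrix (Fin N) (Fin N) ℂ) * Δ).trace‖ ^ 2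
            ∂(haarProbability (SUN N)).tilted (fun g => (N : ℝ) * ((g : Matrix (Fin N) (Fin N) ℂ) * B).trace.re)) := by
  have hN0 : N ≠ 0 := by omega
  have h3 : (3 : ℝ) ≤ N := by exact_mod_cast hN
  have hN4 : (0 : ℝ) < (N : ℝ) ^ 2 - 4 := by nlinarith
  have hNpos : (0 : ℝ) < N := by linarith
  set κw : ℝ := (N : ℝ) ^ 2 / (4 * ((N : ℝ) ^ 2 - 4)) with hκw
  set κt : ℝ := (N : ℝ) / (2 * ((N : ℝ) ^ 2 - 4)) with hκt
  set c : ℝ := 1 / (4 * (N : ℝ)) with hc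
  have hκw0 : 0 ≤ κw := by positivity
  have hκt0 : 0 ≤ κt := by positivity
  have hc0 : 0 ≤ c := by positivity
  have hcκ : c ≤ κt := by
    rw [hc, hκt, div_le_div_iff₀ (by positivity) (by positivity)]
    nlinarith
  set ν : Measure (SUN N) :=
    (haarProbability (SUN N)).tilted (fun g => (N : ℝ) * ((g : Matrix (Fin N) (Fin N) ℂ) * B).trace.re) with hν
  have hexpi : Integrable (fun g : SUN N => Real.exp ((N : ℝ) * ((g : Matrix (Fin N) (Fin N) ℂ) * B).trace.re))
      (haarProbability (SUN N)) :=
    integrable_of_continuous_SUN (Real.continuous_exp.comp (continuous_restrict (contDiff_pot (N : ℝ) B))) _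
  haveI : IsProbabilityMeasure ν := isProbabilityMeasure_tilted hexpi
  have hc3 := contDiff_Gam (contDiff_pot (N := N) 1 B) (contDiff_psiTwo N B Δ)
  -- the affine majorant `a + b ‖z₁‖ + c ‖z₂‖`
  set a : ℝ := 4 * κw * matrixOpNorm B ^ 2 * frobNorm Δ
    + frobNorm B ^ 2 * frobNorm Δ * (2 * κw / N + 3 / 2 * (κt + c) + 1 / 2 * (κt - c)) with ha
  set b₁ : ℝ := frobNorm Δ * matrixOpNorm B * (4 * κw / N + (κt + c) + 2 * κt) with hb₁
  set b₂ : ℝ := frobNorm B * ((κt + c) * matrixOpNorm B + 2 * κt * matrixOpNorm B + 2 * κt / N * Real.sqrt N * frobNorm B)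
    with hb₂
  have hB0 := matrixOpNorm_nonneg B
  have hBF := frobNorm_nonneg B
  have hΔ := frobNorm_nonneg Δ
  set κm : ℝ := κt - c with hκm
  have hκc : 0 ≤ κm := by rw [hκm]; linarith
  have ha0 : 0 ≤ a := by positivity
  have hb₁0 : 0 ≤ b₁ := by positivity
  have hb₂0 : 0 ≤ b₂ := by positivity
  set fb : SUN N → ℝ := fun g => b₁ * ‖((g : Matrix (Fin N) (Fin N) ℂ) * B).trace‖ with hfb
  set fc : SUN N → ℝ := fun g => b₂ * ‖((g : Matrix (Fin N) (Fin N) ℂ) * Δ).trace‖ with hfc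
  have htr : ∀ M : Matrix (Fin N) (Fin N) ℂ, Continuous fun g : SUN N => ((g : Matrix (Fin N) (Fin N) ℂ) * M).trace :=
    fun M => (continuous_subtype_val.matrix_mul continuous_const).matrix_trace
  have hfbc : Continuous fb := continuous_const.mul (continuous_norm.comp (htr B))
  have hfcc : Continuous fc := continuous_const.mul (continuous_norm.comp (htr Δ))
  have key := sqrt_integral_le_of_le_add_sq (a := a) (continuous_restrict (contDiff_Gam hc3 hc3)) hfbc hfcc ha0
    (fun g => ?_) ν
  · have eb : Real.sqrt (∫ x, fb x ^ 2 ∂ν) = b₁ *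
        Real.sqrt (∫ g, ‖((g : Matrix (Fin N) (Fin N) ℂ) * B).trace‖ ^ 2 ∂ν) := by
      have : (fun x => fb x ^ 2) = fun g : SUN N => b₁ ^ 2 * ‖((g : Matrix (Fin N) (Fin N) ℂ) * B).trace‖ ^ 2 := by
        funext g; simp only [hfb]; ring
      rw [this, integral_const_mul, Real.sqrt_mul (sq_nonneg _), Real.sqrt_sq hb₁0]
    have ec : Real.sqrt (∫ x, fc x ^ 2 ∂ν) = b₂ *
        Real.sqrt (∫ g, ‖((g : Matrix (Fin N) (Fin N) ℂ) * Δ).trace‖ ^ 2 ∂ν) := by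
      have : (fun x => fc x ^ 2) = fun g : SUN N => b₂ ^ 2 * ‖((g : Matrix (Fin N) (Fin N) ℂ) * Δ).trace‖ ^ 2 := by
        funext g; simp only [hfc]; ring
      rw [this, integral_const_mul, Real.sqrt_mul (sq_nonneg _), Real.sqrt_sq hb₂0]
    rw [eb, ec] at key
    exact key
  · -- pointwise: `Γ(c₃,c₃)(g) ≤ P(g)² ≤ (a + b₁‖z₁‖ + b₂‖z₂‖)²`
    have hP := Gam_c3_le hN B Δ g
    have haff := c3bound_le_affine hN B Δ g
    rw [← hκw, ← hκt, ← hc] at haff hP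
    have hP0 : 0 ≤ 4 * κw * matrixOpNorm B ^ 2 * frobNorm Δ
        + 2 * κw / N *
          (2 * matrixOpNorm B * frobNorm Δ * |((g : Matrix (Fin N) (Fin N) ℂ) * B).trace.im|
            + frobNorm B * ‖((g : Matrix (Fin N) (Fin N) ℂ) * Δ * g * B).trace‖)
        + 1 / 2 * (κt + c) *
          (2 * matrixOpNorm B * frobNorm B * ‖((g : Matrix (Fin N) (Fin N) ℂ) * Δ).trace‖
            + frobNorm Δ * ‖((g : Matrix (Fin N) (Fin N) ℂ) * B * g * B).trace‖)
        + 1 / 2 * (κt + c) *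
          (2 * matrixOpNorm B * frobNorm Δ * ‖((g : Matrix (Fin N) (Fin N) ℂ) * B).trace‖
            + frobNorm B * ‖((g : Matrix (Fin N) (Fin N) ℂ) * Δ * g * B).trace‖)
        + 1 / 2 * κm * frobNorm B ^ 2 * frobNorm Δ
        + 1 / 2 * (κt + c) * frobNorm B ^ 2 * frobNorm Δ
        + 2 * κt / N *
          (frobNorm B * |((g : Matrix (Fin N) (Fin N) ℂ) * B).trace.im| * ‖((g : Matrix (Fin N) (Fin N) ℂ) * Δ).trace‖
            + frobNorm Δ * |((g : Matrix (Fin N) (Fin N) ℂ) * B).trace.im| * ‖((g : Matrix (Fin N) (Fin N) ℂ) * B).trace‖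
            + frobNorm B * ‖((g : Matrix (Fin N) (Fin N) ℂ) * B).trace‖ * ‖((g : Matrix (Fin N) (Fin N) ℂ) * Δ).trace‖) := by
      positivity
    simp only [hfb, hfc]
    calc _ ≤ _ := hP
      _ ≤ (a + b₁ * ‖((g : Matrix (Fin N) (Fin N) ℂ) * B).trace‖ + b₂ * ‖((g : Matrix (Fin N) (Fin N) ℂ) * Δ).trace‖) ^ 2 := by
          refine pow_le_pow_left₀ hP0 ?_ 2
          calc _ ≤ _ := haff
            _ = _ := by simp only [ha, hb₁, hb₂]; ring

/-- **The `L²(ν_B)` gradient norm of `u + ψ₂`** (`u = Re tr(·Δ)`):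
`√(∫ Γ(u+ψ₂, u+ψ₂) dν_B) ≤ ‖Δ‖_F + 2κ_w‖B‖_op‖Δ‖_F + κ₁(‖Δ‖_F Z₁ + ‖B‖_F Z₂)`. [folklore] -/
theorem sqrt_integral_Gam_upsi_le (hN : 3 ≤ N) (B Δ : Matrix (Fin N) (Fin N) ℂ) :
    Real.sqrt (∫ g, Gam (pot 1 Δ + fun Q : Matrix (Fin N) (Fin N) ℂ =>
          -((N : ℝ) ^ 2 / (4 * ((N : ℝ) ^ 2 - 4))) * (Q * Δ * Q * B).trace.re
            + ((N : ℝ) / (2 * ((N : ℝ) ^ 2 - 4))) * ((Q * B).trace * (Q * Δ).trace).re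
            - (1 / (4 * (N : ℝ))) * ((Q * B).trace * (starRingEnd ℂ) (Q * Δ).trace).re)
        (pot 1 Δ + fun Q : Matrix (Fin N) (Fin N) ℂ =>
          -((N : ℝ) ^ 2 / (4 * ((N : ℝ) ^ 2 - 4))) * (Q * Δ * Q * B).trace.re
            + ((N : ℝ) / (2 * ((N : ℝ) ^ 2 - 4))) * ((Q * B).trace * (Q * Δ).trace).re
            - (1 / (4 * (N : ℝ))) * ((Q * B).trace * (starRingEnd ℂ) (Q * Δ).trace).re) g
        ∂(haarProbability (SUN N)).tilted (fun g => (N : ℝ) * ((g : Matrix (Fin N) (Fin N) ℂ) * B).trace.re)) ≤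
      (frobNorm Δ + (N : ℝ) ^ 2 / (4 * ((N : ℝ) ^ 2 - 4)) * (2 * matrixOpNorm B * frobNorm Δ))
        + ((N : ℝ) / (2 * ((N : ℝ) ^ 2 - 4)) + 1 / (4 * (N : ℝ))) * frobNorm Δ *
          Real.sqrt (∫ g, ‖((g : Matrix (Fin N) (Fin N) ℂ) * B).trace‖ ^ 2
            ∂(haarProbability (SUN N)).tilted (fun g => (N : ℝ) * ((g : Matrix (Fin N) (Fin N) ℂ) * B).trace.re))
        + ((N : ℝ) / (2 * ((N : ℝ) ^ 2 - 4)) + 1 / (4 * (N : ℝ))) * frobNorm B *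
          Real.sqrt (∫ g, ‖((g : Matrix (Fin N) (Fin N) ℂ) * Δ).trace‖ ^ 2
            ∂(haarProbability (SUN N)).tilted (fun g => (N : ℝ) * ((g : Matrix (Fin N) (Fin N) ℂ) * B).trace.re)) := by
  have hN0 : N ≠ 0 := by omega
  have h3 : (3 : ℝ) ≤ N := by exact_mod_cast hN
  have hN4 : (0 : ℝ) < (N : ℝ) ^ 2 - 4 := by nlinarith
  have hNpos : (0 : ℝ) < N := by linarith
  set κw : ℝ := (N : ℝ) ^ 2 / (4 * ((N : ℝ) ^ 2 - 4)) with hκw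
  set κ1 : ℝ := (N : ℝ) / (2 * ((N : ℝ) ^ 2 - 4)) + 1 / (4 * (N : ℝ)) with hκ1
  have hκw0 : 0 ≤ κw := by positivity
  have hκ10 : 0 ≤ κ1 := by positivity
  set ν : Measure (SUN N) :=
    (haarProbability (SUN N)).tilted (fun g => (N : ℝ) * ((g : Matrix (Fin N) (Fin N) ℂ) * B).trace.re) with hν
  have hexpi : Integrable (fun g : SUN N => Real.exp ((N : ℝ) * ((g : Matrix (Fin N) (Fin N) ℂ) * B).trace.re))
      (haarProbability (SUN N)) :=
    integrable_of_continuous_SUN (Real.continuous_exp.comp (continuous_restrict (contDiff_pot (N : ℝ) B))) _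
  haveI : IsProbabilityMeasure ν := isProbabilityMeasure_tilted hexpi
  have hψ := contDiff_psiTwo N B Δ
  have hu : ContDiff ℝ ∞ (pot (N := N) 1 Δ) := contDiff_pot 1 Δ
  have hΨ := hu.add hψ
  have hB0 := matrixOpNorm_nonneg B
  have hBF := frobNorm_nonneg B
  have hΔ := frobNorm_nonneg Δ
  set b : SUN N → ℝ := fun g => κ1 * frobNorm Δ * ‖((g : Matrix (Fin N) (Fin N) ℂ) * B).trace‖ with hb
  set c : SUN N → ℝ := fun g => κ1 * frobNorm B * ‖((g : Matrix (Fin N) (Fin N) ℂ) * Δ).trace‖ with hc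
  have htr : ∀ M : Matrix (Fin N) (Fin N) ℂ, Continuous fun g : SUN N => ((g : Matrix (Fin N) (Fin N) ℂ) * M).trace :=
    fun M => (continuous_subtype_val.matrix_mul continuous_const).matrix_trace
  have hbc : Continuous b := continuous_const.mul (continuous_norm.comp (htr B))
  have hcc : Continuous c := continuous_const.mul (continuous_norm.comp (htr Δ))
  have ha0 : 0 ≤ frobNorm Δ + κw * (2 * matrixOpNorm B * frobNorm Δ) := by positivity
  have key := sqrt_integral_le_of_le_add_sq (a := frobNorm Δ + κw * (2 * matrixOpNorm B * frobNorm Δ))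
    (continuous_restrict (contDiff_Gam hΨ hΨ)) hbc hcc ha0 (fun g => ?_) ν
  · have eb : Real.sqrt (∫ x, b x ^ 2 ∂ν) = κ1 * frobNorm Δ *
        Real.sqrt (∫ g, ‖((g : Matrix (Fin N) (Fin N) ℂ) * B).trace‖ ^ 2 ∂ν) := by
      have : (fun x => b x ^ 2) = fun g : SUN N => (κ1 * frobNorm Δ) ^ 2 * ‖((g : Matrix (Fin N) (Fin N) ℂ) * B).trace‖ ^ 2 := by
        funext g; simp only [hb]; ring
      rw [this, integral_const_mul, Real.sqrt_mul (sq_nonneg _), Real.sqrt_sq (mul_nonneg hκ10 hΔ)]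
    have ec : Real.sqrt (∫ x, c x ^ 2 ∂ν) = κ1 * frobNorm B *
        Real.sqrt (∫ g, ‖((g : Matrix (Fin N) (Fin N) ℂ) * Δ).trace‖ ^ 2 ∂ν) := by
      have : (fun x => c x ^ 2) = fun g : SUN N => (κ1 * frobNorm B) ^ 2 * ‖((g : Matrix (Fin N) (Fin N) ℂ) * Δ).trace‖ ^ 2 := by
        funext g; simp only [hc]; ring
      rw [this, integral_const_mul, Real.sqrt_mul (sq_nonneg _), Real.sqrt_sq (mul_nonneg hκ10 hBF)]
    rw [eb, ec] at key
    exact key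
  · -- pointwise frame bound for `u + ψ₂`
    rw [Gam_self_eq_sum_sq]
    refine sum_sq_apply_frame_le hN0 (dirFun _ _) fun A => ?_
    rw [dirFun_apply, matD_fun_add hu hψ]
    have h1 : |matD A (pot (N := N) 1 Δ) g| ≤ frobNorm Δ * frobNorm A := by
      rw [matD_pot_one]
      refine (abs_re_trace_mul_le _ _).trans ?_
      rw [frobNorm_mul_unitary _ (SUN.mem_unitaryGroup g), mul_comm]
    have h2 := abs_matD_psiTwo_le hN B Δ A g
    rw [← hκw, ← hκ1] at h2
    have hA := frobNorm_nonneg A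
    simp only [hb, hc]
    refine (abs_add_le _ _).trans ?_
    linarith [h1, h2]

end Summit.Ventures.YMGap.OneLinkEigen
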